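/-
b2b-lace packet, LEAN TYPING SEAT 2 gen 17 (unit `b2b-lace-lean2-g17`).  (S2b)-IMPR TABMONO, pointwise form: the table-monotonicity of the
`f₃` numerator `boundHD75` (module `F3BoundsTablesMono`, lean2-g15, global entrywise order `Tables.Dom`) transported to domination AT ONE
NODE `v` — the form the assembly uses (the Step leaves are stated at the TRUE SRW integrals `τ.K = srwK`, `τ.U = srwU`, `srwTS ≤ τ.T` at the
node `x`; the certified cell tables dominate them only on their cell, i.e. at the node, not at every `v`).  Additive; `F3Bounds*.lean` unchanged.
-/
import Literature.Probability.FitznerVanDerHofstad2017.F3BoundsTablesMono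
import HarnessLib

/-!
# `boundHD75` is monotone in the table entries AT THE NODE it is read at

CITATION HEADER (PLACEMENT v2). Part of a certified REPRODUCTION of R. Fitzner, R. van der Hofstad, *Generalized approach to the
non-backtracking lace expansion*, Probab. Theory Related Fields 169 (2017) 1041–1119 [NoBLE17] (§3.3.5 (3.71)–(3.87): the bounds
`BoundH[i]` are linear in the SRW tables with non-negative coefficients on well-formed arguments) and *Mean-field behavior for
nearest-neighbor percolation in `d > 10`*, Electron. J. Probab. 22 (2017) no. 43 [FvdH17] (notebook `General.nb` In[2]–In[3]).
Everything here is elementary order algebra ([folklore]); no dimension is mentioned; nothing is a cited fact.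

`F3Bounds.boundHD75 τ n l v a` reads the table `τ` only at the node `v` (definitionally: replacing `τ` by the table frozen at `v`,
`(m, l', w) ↦ τ.• m l' v`, does not change the value — `boundHD75_eq_frozenAt`, by `rfl`).  Hence the global monotonicity
`F3Bounds.boundHD75_tmono` (hypothesis `Tables.Dom τ τ'`: every entry at every node) already holds under domination of the entries at
the single node `v` (`boundHD75_mono_at`), and likewise for `boundH1`, `boundH2`, `boundH3`, `boundH4D75`, `boundH5` and the printed-Step-4
numerator `boundH`.  This is the glue between a pointwise analytic bound `|ℋ^{n,l}_p(x)| ≤ boundHD75 τ₀ n l x r` at the true SRW table `τ₀`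
and a certified table `τ₁ ≥ τ₀` valid on a cell containing `x`.
-/

noncomputable section

namespace Literature.Probability.FitznerVanDerHofstad2017
namespace F3Bounds

variable {ν : Type*}

/-- The table `τ` frozen at the node `v`: every node reads the entries of `τ` at `v`. [folklore] -/
def Tables.frozenAt (τ : Tables ν) (v : ν) : Tables ν :=
  ⟨fun m l _ => τ.IM m l v, fun m l _ => τ.T m l v, fun m l _ => τ.U m l v, fun m l _ => τ.K m l v⟩

/-- Domination of the entries at one node gives `Tables.Dom` of the frozen tables. [folklore] -/
theorem Tables.dom_frozenAt {τ τ' : Tables ν} {v : ν} (hIM : ∀ m l, τ.IM m l v ≤ τ'.IM m l v)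
    (hT : ∀ m l, τ.T m l v ≤ τ'.T m l v) (hU : ∀ m l, τ.U m l v ≤ τ'.U m l v) (hK : ∀ m l, τ.K m l v ≤ τ'.K m l v) :
    Tables.Dom (τ.frozenAt v) (τ'.frozenAt v) :=
  ⟨fun m l _ => hIM m l, fun m l _ => hT m l, fun m l _ => hU m l, fun m l _ => hK m l⟩

section Frozen

variable (τ : Tables ν) (n l : ℕ) (v : ν) (a : Args)

/-- `boundH1` reads the table only at the node. [folklore] -/
theorem boundH1_eq_frozenAt : boundH1 τ n l v a = boundH1 (τ.frozenAt v) n l v a := rfl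
/-- `boundH2` reads the table only at the node. [folklore] -/
theorem boundH2_eq_frozenAt : boundH2 τ n l v a = boundH2 (τ.frozenAt v) n l v a := rfl
/-- `boundH3` reads the table only at the node. [folklore] -/
theorem boundH3_eq_frozenAt : boundH3 τ n l v a = boundH3 (τ.frozenAt v) n l v a := rfl
/-- `boundH4` reads the table only at the node. [folklore] -/
theorem boundH4_eq_frozenAt : boundH4 τ n l v a = boundH4 (τ.frozenAt v) n l v a := rfl
/-- `boundH4D75` reads the table only at the node. [folklore] -/
theorem boundH4D75_eq_frozenAt : boundH4D75 τ n l v a = boundH4D75 (τ.frozenAt v) n l v a := rfl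
/-- `boundH5` reads the table only at the node. [folklore] -/
theorem boundH5_eq_frozenAt : boundH5 τ n l v a = boundH5 (τ.frozenAt v) n l v a := rfl
/-- `boundH` reads the table only at the node. [folklore] -/
theorem boundH_eq_frozenAt : boundH τ n l v a = boundH (τ.frozenAt v) n l v a := rfl
/-- `boundHD75` reads the table only at the node. [folklore] -/
theorem boundHD75_eq_frozenAt : boundHD75 τ n l v a = boundHD75 (τ.frozenAt v) n l v a := rfl

end Frozen

section MonoAt

variable {τ τ' : Tables ν} {v : ν} {a : Args}

/-- (3.71) `BoundH[1]` is monotone in the table entries at the node (well-formed arguments). [folklore] -/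
theorem boundH1_mono_at (ha : a.WF) (hIM : ∀ m l, τ.IM m l v ≤ τ'.IM m l v) (hT : ∀ m l, τ.T m l v ≤ τ'.T m l v)
    (hU : ∀ m l, τ.U m l v ≤ τ'.U m l v) (hK : ∀ m l, τ.K m l v ≤ τ'.K m l v) (n l : ℕ) :
    boundH1 τ n l v a ≤ boundH1 τ' n l v a := by
  rw [boundH1_eq_frozenAt τ, boundH1_eq_frozenAt τ']
  exact boundH1_tmono (Tables.dom_frozenAt hIM hT hU hK) ha n l v

/-- (3.74) `BoundH[2]` is monotone in the table entries at the node (well-formed arguments). [folklore] -/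
theorem boundH2_mono_at (ha : a.WF) (hIM : ∀ m l, τ.IM m l v ≤ τ'.IM m l v) (hT : ∀ m l, τ.T m l v ≤ τ'.T m l v)
    (hU : ∀ m l, τ.U m l v ≤ τ'.U m l v) (hK : ∀ m l, τ.K m l v ≤ τ'.K m l v) (n l : ℕ) :
    boundH2 τ n l v a ≤ boundH2 τ' n l v a := by
  rw [boundH2_eq_frozenAt τ, boundH2_eq_frozenAt τ']
  exact boundH2_tmono (Tables.dom_frozenAt hIM hT hU hK) ha n l v

/-- (3.77) `BoundH[3]` is monotone in the table entries at the node (well-formed arguments). [folklore] -/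
theorem boundH3_mono_at (ha : a.WF) (hIM : ∀ m l, τ.IM m l v ≤ τ'.IM m l v) (hT : ∀ m l, τ.T m l v ≤ τ'.T m l v)
    (hU : ∀ m l, τ.U m l v ≤ τ'.U m l v) (hK : ∀ m l, τ.K m l v ≤ τ'.K m l v) (n l : ℕ) :
    boundH3 τ n l v a ≤ boundH3 τ' n l v a := by
  rw [boundH3_eq_frozenAt τ, boundH3_eq_frozenAt τ']
  exact boundH3_tmono (Tables.dom_frozenAt hIM hT hU hK) ha n l v

/-- The App.-C-consistent Step-4 summand `boundH4D75` is monotone in the table entries at the node (well-formed arguments). [folklore] -/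
theorem boundH4D75_mono_at (ha : a.WF) (hIM : ∀ m l, τ.IM m l v ≤ τ'.IM m l v) (hT : ∀ m l, τ.T m l v ≤ τ'.T m l v)
    (hU : ∀ m l, τ.U m l v ≤ τ'.U m l v) (hK : ∀ m l, τ.K m l v ≤ τ'.K m l v) (n l : ℕ) :
    boundH4D75 τ n l v a ≤ boundH4D75 τ' n l v a := by
  rw [boundH4D75_eq_frozenAt τ, boundH4D75_eq_frozenAt τ']
  exact boundH4D75_tmono (Tables.dom_frozenAt hIM hT hU hK) ha n l v

/-- (3.86) `BoundH[5]` is monotone in the table entries at the node (well-formed arguments). [folklore] -/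
theorem boundH5_mono_at (ha : a.WF) (hIM : ∀ m l, τ.IM m l v ≤ τ'.IM m l v) (hT : ∀ m l, τ.T m l v ≤ τ'.T m l v)
    (hU : ∀ m l, τ.U m l v ≤ τ'.U m l v) (hK : ∀ m l, τ.K m l v ≤ τ'.K m l v) (n l : ℕ) :
    boundH5 τ n l v a ≤ boundH5 τ' n l v a := by
  rw [boundH5_eq_frozenAt τ, boundH5_eq_frozenAt τ']
  exact boundH5_tmono (Tables.dom_frozenAt hIM hT hU hK) ha n l v

/-- The printed numerator `boundH` of (3.87) is monotone in the table entries at the node (well-formed arguments). [folklore] -/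
theorem boundH_mono_at (ha : a.WF) (hIM : ∀ m l, τ.IM m l v ≤ τ'.IM m l v) (hT : ∀ m l, τ.T m l v ≤ τ'.T m l v)
    (hU : ∀ m l, τ.U m l v ≤ τ'.U m l v) (hK : ∀ m l, τ.K m l v ≤ τ'.K m l v) (n l : ℕ) :
    boundH τ n l v a ≤ boundH τ' n l v a := by
  rw [boundH_eq_frozenAt τ, boundH_eq_frozenAt τ']
  exact boundH_tmono (Tables.dom_frozenAt hIM hT hU hK) ha n l v

/-- **The App.-C-consistent numerator `boundHD75` of (3.87) is monotone in the table entries at the node** (well-formed arguments):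
if `τ ≤ τ'` entrywise AT `v`, then `boundHD75 τ n l v a ≤ boundHD75 τ' n l v a`.
[cite: FitznerVanDerHofstad2016NoBLE, §3.3.5 (3.71)–(3.87) pp. 1075–1079 (linearity of BoundH[i] in the tables)] -/
theorem boundHD75_mono_at (ha : a.WF) (hIM : ∀ m l, τ.IM m l v ≤ τ'.IM m l v) (hT : ∀ m l, τ.T m l v ≤ τ'.T m l v)
    (hU : ∀ m l, τ.U m l v ≤ τ'.U m l v) (hK : ∀ m l, τ.K m l v ≤ τ'.K m l v) (n l : ℕ) :
    boundHD75 τ n l v a ≤ boundHD75 τ' n l v a := by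
  rw [boundHD75_eq_frozenAt τ, boundHD75_eq_frozenAt τ']
  exact boundHD75_tmono (Tables.dom_frozenAt hIM hT hU hK) ha n l v

end MonoAt

end F3Bounds
end Literature.Probability.FitznerVanDerHofstad2017

end
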